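import Summits.ResolutionOfSingularities.ResolutionOfSingularities.Theorems.FrobeniusLadderFInjectiveMacaulayficationGDDDefs
import Mathlib.RingTheory.FiniteType
import Mathlib.RingTheory.Adjoin.FG
import Mathlib.RingTheory.ReesAlgebra
import HarnessLib

/-!
# `G(F)` is NOETHERIAN when `F` has a Veronese exponent (Hashimoto bridge (β), part 3: `hV ⇒ hNoeth`)
# (crux `FInjectiveMacaulayfication` stmt-ResolutionOfSingularities-15315, chain w45a, THEOREM-D programme (A1); res-L1-w45a-idea-1 ThmDSig §3d binder
# `(hV : ∃ N, 0 < N ∧ IsVeronese F N)`; seat res-L1-w45a-stub-2)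

[OURS · L1 W4.5a] Support file (`--supports stmt-ResolutionOfSingularities-15315 --as helper`); NOT a statement of any manuscript; def-free, unconditional;
AI-written (AI review is weaker than expert review).

§1 If the filtration is EVENTUALLY STANDARD (`I_n ⊆ I_N · I_{n-N}` for `n > D`, some `N ≥ 1`), the extended Rees algebra `𝓡(F) = R[I_n Tⁿ, T⁻¹]`
over a Noetherian `R` is generated by `T⁻¹` and the `a·Tⁿ`, `n ≤ max D N`, `a` in finite generating sets of the `I_n` — so it is of finite type,
hence Noetherian, and so is `G(F) = 𝓡(F)/(T⁻¹)`.
§2 A VERONESE exponent (`I_{kN} = I_Nᵏ`) makes the filtration eventually standard: for each residue `i < N`, `𝔞_i = ⊕_k I_{kN+i} Xᵏ` is an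
ideal of the (Noetherian) Rees algebra `R[I_N X]` (`I_{kN+i} ⊆ I_{kN} = I_Nᵏ`), hence generated in `X`-degrees `≤ K`; comparing coefficients,
`I_{kN+i} ⊆ I_N · I_{(k-1)N+i}` for `k > K`. [folklore: Bourbaki, Alg. Comm. III §1 no. 3; Bruns–Herzog 4.5]
§3 `isNoetherianRing_assocGraded_of_isVeronese`.
-/

-- single-problem summit: the doubled namespace component is forced
set_option linter.dupNamespace false

noncomputable section

namespace Summit.ResolutionOfSingularities.ResolutionOfSingularities.Theorems.FInjectiveMacaulayfication.AssocGradedNoetherian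

open Summit.ResolutionOfSingularities.ResolutionOfSingularities.Theorems.FInjectiveMacaulayfication
open GDD LaurentPolynomial

variable {R : Type} [CommRing R] (F : MultFiltration R)

/-! ## §1 Eventually standard filtrations have finitely generated extended Rees algebras -/

/-- **`𝓡(F)` is finitely generated** when `I_n ⊆ I_N·I_{n-N}` for all `n > D` (`N ≥ 1`) and `R` is Noetherian: generators `T⁻¹` and `a·Tⁿ` for
`n ≤ max D N`, `a` running through finite generating sets of the `I_n`. [folklore] -/
theorem extRees_fg_of_eventually_standard [IsNoetherianRing R] (N D : ℕ) (hN : 0 < N)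
    (hD : ∀ n : ℕ, D < n → F.I n ≤ F.I N * F.I (n - N)) : (extRees F).FG := by
  classical
  -- finite generating sets of the ideals `I_n`
  have hfg : ∀ n : ℕ, ∃ G : Finset R, Ideal.span (G : Set R) = F.I n := fun n => IsNoetherian.noetherian (F.I n)
  choose G hG using hfg
  set D' := max D N with hD'
  let S : Finset (LaurentPolynomial R) :=
    {T (-1)} ∪ (Finset.range (D' + 1)).biUnion fun n => (G n).image fun a => C a * T (n : ℤ)
  refine ⟨S, le_antisymm ?_ ?_⟩
  · -- the generators lie in `𝓡(F)`
    refine Algebra.adjoin_le fun x hx => ?_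
    simp only [S, Finset.coe_union, Finset.coe_singleton, Finset.coe_biUnion, Finset.coe_image, Set.mem_union,
      Set.mem_singleton_iff, Set.mem_iUnion, Set.mem_image, Finset.mem_coe, Finset.mem_range] at hx
    rcases hx with rfl | ⟨n, -, a, ha, rfl⟩
    · exact T_neg_one_mem F
    · have ha' : a ∈ F.I n := by rw [← hG n]; exact Ideal.subset_span ha
      exact homog_mem F n a ha'
  · -- every `a·Tⁿ` (`a ∈ I_n`) lies in the algebra generated by `S`: strong induction on `n`
    have hT : T (-1) ∈ Algebra.adjoin R (S : Set (LaurentPolynomial R)) :=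
      Algebra.subset_adjoin (by simp [S])
    have key : ∀ n : ℕ, ∀ a ∈ F.I n, C a * T (n : ℤ) ∈ Algebra.adjoin R (S : Set (LaurentPolynomial R)) := by
      intro n
      induction n using Nat.strong_induction_on with
      | _ n ih =>
        intro a ha
        by_cases hn : n ≤ D'
        · -- small degree: through the generators of `I_n`
          rw [← hG n] at ha
          induction ha using Submodule.span_induction with
          | mem x hx =>
            exact Algebra.subset_adjoin (by
              simp only [S, Finset.coe_union, Finset.coe_biUnion, Finset.coe_image, Set.mem_union, Set.mem_iUnion,
                Set.mem_image, Finset.mem_coe, Finset.mem_range]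
              exact Or.inr ⟨n, by omega, x, hx, rfl⟩)
          | zero => rw [map_zero, zero_mul]; exact Subalgebra.zero_mem _
          | add x y _ _ hx hy => rw [map_add, add_mul]; exact Subalgebra.add_mem _ hx hy
          | smul r x _ hx =>
            rw [smul_eq_mul, map_mul, mul_assoc]
            refine Subalgebra.mul_mem _ ?_ hx
            rw [C_eq_algebraMap]
            exact Subalgebra.algebraMap_mem _ r
        · -- large degree: `a ∈ I_N · I_{n-N}`
          have hDn : D < n := by omega
          have hNn : N ≤ n := by omega
          have ha' : a ∈ F.I N * F.I (n - N) := hD n hDn ha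
          refine Submodule.mul_induction_on (C := fun a => C a * T (n : ℤ) ∈ Algebra.adjoin R (S : Set (LaurentPolynomial R))) ha'
            (fun b hb c hc => ?_) (fun x y hx hy => ?_)
          · have h1 := ih N (by omega) b hb
            have h2 := ih (n - N) (by omega) c hc
            have heq : C (b * c) * T (n : ℤ) = (C b * T (N : ℤ)) * (C c * T ((n - N : ℕ) : ℤ)) := by
              rw [map_mul, Nat.cast_sub hNn, mul_mul_mul_comm, ← T_add]
              congr 2
              ring
            rw [heq]
            exact Subalgebra.mul_mem _ h1 h2
          · rw [map_add, add_mul]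
            exact Subalgebra.add_mem _ hx hy
    -- conclude: `𝓡(F) = adjoin (reesGens) ≤ adjoin S`
    refine Algebra.adjoin_le fun x hx => ?_
    rcases hx with hx | hx
    · rw [Set.mem_singleton_iff] at hx
      subst hx
      exact hT
    · obtain ⟨n, hn⟩ := Set.mem_iUnion.mp hx
      obtain ⟨a, ha, rfl⟩ := hn
      exact key n a ha

/-- Hence `𝓡(F)` and `G(F)` are Noetherian for an eventually standard filtration over a Noetherian ring. [folklore] -/
theorem isNoetherianRing_extRees_of_eventually_standard [IsNoetherianRing R] (N D : ℕ) (hN : 0 < N)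
    (hD : ∀ n : ℕ, D < n → F.I n ≤ F.I N * F.I (n - N)) : IsNoetherianRing (extRees F) := by
  haveI : Algebra.FiniteType R (extRees F) :=
    (Subalgebra.fg_iff_finiteType _).mp (extRees_fg_of_eventually_standard F N D hN hD)
  exact Algebra.FiniteType.isNoetherianRing R _

/-! ## §2 A Veronese exponent makes the filtration eventually standard -/

/-- **Degree bound for one residue class.** If `I_{kN} = I_Nᵏ` for all `k` and `R` is Noetherian, then for each `i` there is `K` with
`I_{kN+i} ⊆ I_N · I_{(k-1)N+i}` for all `k > K`: the ideal `𝔞_i = ⊕_k I_{kN+i} Xᵏ` of the Noetherian Rees algebra `R[I_N X]` is generated in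
`X`-degrees `≤ K`. [folklore: Bourbaki, Alg. Comm. III §1 no. 3] -/
theorem exists_bound_of_isVeronese [IsNoetherianRing R] {N : ℕ} (hV : IsVeronese F N) (i : ℕ) :
    ∃ K : ℕ, ∀ k : ℕ, K < k → F.I (k * N + i) ≤ F.I N * F.I ((k - 1) * N + i) := by
  classical
  obtain ⟨hN, hVer⟩ := hV
  -- `I_{kN + i} ⊆ I_{kN} = I_N ^ k`
  have hsub : ∀ k : ℕ, F.I (k * N + i) ≤ F.I N ^ k := fun k => (F.antitone (Nat.le_add_right _ _)).trans (hVer k).le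
  -- the ideal `𝔞 = ⊕_k I_{kN+i} X^k` of the Rees algebra `A = R[I_N X]`
  let A : Subalgebra R (Polynomial R) := reesAlgebra (F.I N)
  let 𝔞 : Ideal A :=
    { carrier := {f | ∀ k : ℕ, (f : Polynomial R).coeff k ∈ F.I (k * N + i)}
      add_mem' := fun {f g} hf hg k => by
        rw [Subalgebra.coe_add, Polynomial.coeff_add]
        exact (F.I _).add_mem (hf k) (hg k)
      zero_mem' := fun k => by
        rw [ZeroMemClass.coe_zero, Polynomial.coeff_zero]
        exact (F.I _).zero_mem
      smul_mem' := fun c {f} hf k => by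
        rw [smul_eq_mul, Subalgebra.coe_mul, Polynomial.coeff_mul]
        refine Ideal.sum_mem _ fun jl hjl => ?_
        have hj : (c : Polynomial R).coeff jl.1 ∈ F.I (jl.1 * N) := by
          rw [hVer]; exact (mem_reesAlgebra_iff _ _).mp c.2 jl.1
        have hsum : jl.1 * N + (jl.2 * N + i) = k * N + i := by
          have := Finset.HasAntidiagonal.mem_antidiagonal.mp hjl
          subst this
          ring
        have h := F.mul_le _ _ (Ideal.mul_mem_mul hj (hf jl.2))
        rwa [hsum] at h }
  -- `𝔞` is finitely generated; `K` bounds the degrees of its generators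
  obtain ⟨G, hG⟩ : 𝔞.FG := IsNoetherian.noetherian 𝔞
  have hG𝔞 : ∀ g ∈ G, (g : A) ∈ 𝔞 := fun g hg => by rw [← hG]; exact Ideal.subset_span hg
  refine ⟨G.sup fun g => (g : Polynomial R).natDegree, fun k hk c hc => ?_⟩
  -- the monomial `c X^k` lies in `𝔞`
  have hmonA : Polynomial.monomial k c ∈ A := by
    rw [mem_reesAlgebra_iff]
    intro j
    rw [Polynomial.coeff_monomial]
    split_ifs with h
    · subst h; exact hsub k hc
    · exact Ideal.zero_mem _
  have hmon : (⟨Polynomial.monomial k c, hmonA⟩ : A) ∈ 𝔞 := by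
    intro j
    change (Polynomial.monomial k c).coeff j ∈ _
    rw [Polynomial.coeff_monomial]
    split_ifs with h
    · subst h; exact hc
    · exact Ideal.zero_mem _
  rw [← hG, Ideal.span, Submodule.mem_span_finset] at hmon
  obtain ⟨h, -, hsum⟩ := hmon
  -- compare the coefficients of `X^k`
  have hcoeff := congrArg (fun q : A => (q : Polynomial R).coeff k) hsum
  simp only [AddSubmonoidClass.coe_finsetSum, smul_eq_mul, Subalgebra.coe_mul, Polynomial.finsetSum_coeff, Polynomial.coeff_mul,
    Polynomial.coeff_monomial, if_true] at hcoeff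
  rw [← hcoeff]
  refine Ideal.sum_mem _ fun g hg => Ideal.sum_mem _ fun jl hjl => ?_
  have hjl' : jl.1 + jl.2 = k := Finset.HasAntidiagonal.mem_antidiagonal.mp hjl
  by_cases hl : jl.2 ≤ (g : Polynomial R).natDegree
  · -- then `j ≥ 1`, and `(h g)_j ∈ I_N^j = I_N · I_{(j-1)N}`
    have hgK : ((g : A) : Polynomial R).natDegree ≤ G.sup fun g => ((g : A) : Polynomial R).natDegree :=
      Finset.le_sup (f := fun g : A => ((g : A) : Polynomial R).natDegree) hg
    have hlK : jl.2 < k := lt_of_le_of_lt (hl.trans hgK) hk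
    have hj1 : 1 ≤ jl.1 := by omega
    have hhj : ((h g : A) : Polynomial R).coeff jl.1 ∈ F.I N * F.I ((jl.1 - 1) * N) := by
      have := (mem_reesAlgebra_iff _ _).mp (h g).2 jl.1
      rw [← Nat.sub_add_cancel hj1, pow_succ', ← hVer] at this
      rwa [Nat.sub_add_cancel hj1] at this
    have hgl : ((g : A) : Polynomial R).coeff jl.2 ∈ F.I (jl.2 * N + i) := hG𝔞 g hg jl.2
    -- `I_N · I_{(j-1)N} · I_{lN+i} ⊆ I_N · I_{(k-1)N+i}`
    have hidx : (jl.1 - 1) * N + (jl.2 * N + i) = (k - 1) * N + i := by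
      have hk1 : k - 1 = (jl.1 - 1) + jl.2 := by omega
      rw [hk1]
      ring
    have hstep : F.I N * F.I ((jl.1 - 1) * N) * F.I (jl.2 * N + i) ≤ F.I N * F.I ((k - 1) * N + i) := by
      rw [mul_assoc]
      exact Ideal.mul_mono_right ((F.mul_le _ _).trans (by rw [hidx]))
    exact hstep (Ideal.mul_mem_mul hhj hgl)
  · -- beyond the degree of `g` the coefficient vanishes
    rw [Polynomial.coeff_eq_zero_of_natDegree_lt (lt_of_not_ge hl), mul_zero]
    exact Ideal.zero_mem _

/-- **A Veronese exponent makes the filtration EVENTUALLY STANDARD**: `I_n ⊆ I_N · I_{n-N}` for all large `n`. [folklore] -/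
theorem eventually_standard_of_isVeronese [IsNoetherianRing R] {N : ℕ} (hV : IsVeronese F N) :
    ∃ D : ℕ, ∀ n : ℕ, D < n → F.I n ≤ F.I N * F.I (n - N) := by
  classical
  have hN := hV.1
  choose K hK using exists_bound_of_isVeronese F hV
  refine ⟨((Finset.range N).sup K + 2) * N, fun n hn => ?_⟩
  -- `n = kN + i` with `i < N` and `k > K i`
  set k := n / N with hk
  set i := n % N with hi
  have hiN : i < N := Nat.mod_lt n hN
  have hn' : k * N + i = n := by rw [mul_comm]; exact Nat.div_add_mod n N
  have hKi : K i ≤ (Finset.range N).sup K := Finset.le_sup (f := K) (Finset.mem_range.mpr hiN)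
  have hkK : K i < k := by
    by_contra hle
    have : n < ((Finset.range N).sup K + 2) * N := by
      rw [← hn']
      have h1 : k * N ≤ ((Finset.range N).sup K) * N := Nat.mul_le_mul_right N (le_trans (not_lt.mp hle) hKi)
      nlinarith
    omega
  have h := hK i k hkK
  have hidx : (k - 1) * N + i = n - N := by
    have hk1 : 1 ≤ k := by omega
    zify [hk1, (by rw [← hn']; nlinarith : N ≤ n)] at hn' ⊢
    nlinarith
  rw [hn', hidx] at h
  exact h

/-! ## §3 Noetherianity of `G(F)` -/

/-- **`𝓡(F)` is Noetherian** when `F` has a Veronese exponent and `R` is Noetherian. [folklore] -/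
theorem isNoetherianRing_extRees_of_isVeronese [IsNoetherianRing R] {N : ℕ} (hV : IsVeronese F N) :
    IsNoetherianRing (extRees F) := by
  obtain ⟨D, hD⟩ := eventually_standard_of_isVeronese F hV
  exact isNoetherianRing_extRees_of_eventually_standard F N D hV.1 hD

/-- **`G(F)` is Noetherian** when `F` has a Veronese exponent and `R` is Noetherian. [folklore] -/
theorem isNoetherianRing_assocGraded_of_isVeronese [IsNoetherianRing R] {N : ℕ} (hV : IsVeronese F N) :
    IsNoetherianRing (assocGraded F) := by
  haveI := isNoetherianRing_extRees_of_isVeronese F hV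
  exact inferInstance

/-- The same from the ThmDSig §3d binder `∃ N, 0 < N ∧ IsVeronese F N`. [plumbing] -/
theorem isNoetherianRing_assocGraded_of_exists_isVeronese [IsNoetherianRing R] (hV : ∃ N, 0 < N ∧ IsVeronese F N) :
    IsNoetherianRing (assocGraded F) := by
  obtain ⟨N, -, hVN⟩ := hV
  exact isNoetherianRing_assocGraded_of_isVeronese F hVN

end Summit.ResolutionOfSingularities.ResolutionOfSingularities.Theorems.FInjectiveMacaulayfication.AssocGradedNoetherian

end
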